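import Summits.AtomisticToContinuum.HydrodynamicLimit.Theorems.OneFlightGossipEngineEnergyCurrentTailsEnergyFluxCeilingRung0
import Literature.MathematicalPhysics.KineticTheory.HardSphereEulerProofs
import Literature.Analysis.FluidPDE.HardSphereCollisionRecord
import HarnessLib

/-!
# Crux `EnergyCurrentTails` (stmt-AtomisticToContinuum-9235), line `quartic-schur-ledger`:
# the dock S2a ⟸ S2a″ (kinetic-window energy-flux ceiling from the all-windows ceiling)

The line's Euler-free, all-windows energy-flux ceiling S2a″ (`stub_energyFluxCeilingWindows`, open
primitive) implies its crux-frame kinetic-window form S2a (`stub_energyFluxCeiling`), consumed by the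
landed S2b glue: given `t < T` and `τ > 0` take the horizon `T″ := t + τ + 1 > 0` in S2a″; a kinetic
window `[s, s′]` with `s ∈ [0, t]`, `s′ ≤ s + τ (N+1)^{-1/3} ≤ t + τ`, lies in `[0, T″]`; `K := C`
(`stub_energyFluxCeiling_of_windows`).  We also restate the landed rung-0 certificate
`stub_energyFluxCeilingRung0` (p102898) in the S2a″ quantifier shape (`energyFluxCeilingWindows_rung0`).
-/

noncomputable section

open MeasureTheory Set Filter
open scoped ENNReal InnerProductSpace

namespace Summit.AtomisticToContinuum.HydrodynamicLimit.Theorems.QuarticSchurLedger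

open Literature.MathematicalPhysics.KineticTheory Literature.Analysis.FluidPDE

/-- **Stub S2a-dock — S2a FROM S2a″ (glue).**  Given `t < T` and `τ > 0` take the horizon
`T″ := t + τ + 1 > 0` in S2a″; a kinetic window `[s, s′]`, `s ∈ [0,t]`,
`s′ ≤ s + τ(N+1)^{-1/3} ≤ t + τ`, lies in `[0, T″]`; `K := C`. -/
theorem stub_energyFluxCeiling_of_windows :
    (∀ (a₀ θ₀ : T3 → ℝ) (u₀ : T3 → V3), Continuous a₀ → Continuous θ₀ → Continuous u₀ →
      (∀ x, 0 < a₀ x) → (∀ x, 0 < θ₀ x) →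
      ∃ σ₀ : ℝ, 0 < σ₀ ∧ ∀ σ : ℝ, 0 < σ → σ < σ₀ → ∀ T : ℝ, 0 < T →
        ∀ Φ : ((N : ℕ) → HardSphereFlow (Torus.geometry (Fin 3)) (hsDiameter σ N) (N + 1)),
          ∃ C : ℝ, 0 ≤ C ∧ ∃ N₀ : ℕ, ∀ N : ℕ, N₀ ≤ N → ∀ s s' : ℝ, 0 ≤ s → s ≤ s' → s' ≤ T →
            (∫⁻ z, ENNReal.ofReal (((N : ℝ) + 1)⁻¹ *
                (Φ N).collisionSum (Set.Ioc s s')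
                  (fun col => ‖col.preVel.1‖ ^ 2 * ‖col.preVel.2‖ ^ 2) z)
              ∂(localGibbsLaw σ a₀ u₀ θ₀ N (Φ N)))
            ≤ ENNReal.ofReal (C * (σ ^ 2 * ((N : ℝ) + 1) ^ (1 / 3 : ℝ) * (s' - s))) *
                (⨆ r ∈ Set.Icc s s',
                  (∫⁻ z, ENNReal.ofReal (((N : ℝ) + 1)⁻¹ *
                      ∑ i : Fin (N + 1), ‖((Φ N).flow r z i).2‖ ^ 2)
                    ∂(localGibbsLaw σ a₀ u₀ θ₀ N (Φ N)))) *
                (⨆ r ∈ Set.Icc s s',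
                  (∫⁻ z, ENNReal.ofReal (((N : ℝ) + 1)⁻¹ *
                      ∑ i : Fin (N + 1), ‖((Φ N).flow r z i).2‖ ^ 3)
                    ∂(localGibbsLaw σ a₀ u₀ θ₀ N (Φ N))))) →
    ∀ (a₀ θ₀ : T3 → ℝ) (u₀ : T3 → V3), Continuous a₀ → Continuous θ₀ → Continuous u₀ →
      (∀ x, 0 < a₀ x) → (∀ x, 0 < θ₀ x) →
      ∃ σ₀ : ℝ, 0 < σ₀ ∧ ∀ σ : ℝ, 0 < σ → σ < σ₀ →
        ∀ (T : ℝ) (ρ θ : ℝ → T3 → ℝ) (u : ℝ → T3 → V3), IsHardSphereEulerSolution σ T ρ u θ →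
          ∀ Φ : (N : ℕ) → HardSphereFlow (Torus.geometry (Fin 3)) (hsDiameter σ N) (N + 1),
            TendstoHydroFieldsAt (fun N => localGibbsLaw σ a₀ u₀ θ₀ N (Φ N)) Φ ρ u θ 0 →
              ∀ t ∈ Set.Ico 0 T, ∀ τ : ℝ, 0 < τ → ∃ K : ℝ, 0 ≤ K ∧
                ∃ N₀ : ℕ, ∀ N : ℕ, N₀ ≤ N → ∀ s ∈ Set.Icc 0 t,
                  ∀ s' ∈ Set.Icc s (s + τ * ((N : ℝ) + 1) ^ (-(1 / 3 : ℝ))),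
                    (∫⁻ z, ENNReal.ofReal (((N : ℝ) + 1)⁻¹ *
                        (Φ N).collisionSum (Set.Ioc s s')
                          (fun col => ‖col.preVel.1‖ ^ 2 * ‖col.preVel.2‖ ^ 2) z)
                      ∂(localGibbsLaw σ a₀ u₀ θ₀ N (Φ N)))
                    ≤ ENNReal.ofReal (K * (σ ^ 2 * ((N : ℝ) + 1) ^ (1 / 3 : ℝ) * (s' - s))) *
                        (⨆ r ∈ Set.Icc s s',
                          (∫⁻ z, ENNReal.ofReal (((N : ℝ) + 1)⁻¹ *
                              ∑ i : Fin (N + 1), ‖((Φ N).flow r z i).2‖ ^ 2)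
                            ∂(localGibbsLaw σ a₀ u₀ θ₀ N (Φ N)))) *
                        (⨆ r ∈ Set.Icc s s',
                          (∫⁻ z, ENNReal.ofReal (((N : ℝ) + 1)⁻¹ *
                              ∑ i : Fin (N + 1), ‖((Φ N).flow r z i).2‖ ^ 3)
                            ∂(localGibbsLaw σ a₀ u₀ θ₀ N (Φ N)))) := by
  intro h a₀ θ₀ u₀ ha hθ hu ha0 hθ0
  obtain ⟨σ₀, hσ₀, H⟩ := h a₀ θ₀ u₀ ha hθ hu ha0 hθ0
  refine ⟨σ₀, hσ₀, fun σ hσ hσlt T ρ θ u _hE Φ _h0 t ht τ hτ => ?_⟩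
  have ht0 : 0 ≤ t := ht.1
  have hT' : 0 < t + τ + 1 := by linarith
  obtain ⟨C, hC, N₀, HN⟩ := H σ hσ hσlt (t + τ + 1) hT' Φ
  refine ⟨C, hC, N₀, fun N hN s hs s' hs' => HN N hN s s' hs.1 hs'.1 ?_⟩
  -- the window sits inside `[0, t + τ + 1]`
  have hN1 : (1 : ℝ) ≤ (N : ℝ) + 1 := by
    have : (0 : ℝ) ≤ (N : ℝ) := Nat.cast_nonneg N
    linarith
  have hpow : ((N : ℝ) + 1) ^ (-(1 / 3 : ℝ)) ≤ 1 :=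
    Real.rpow_le_one_of_one_le_of_nonpos hN1 (by norm_num)
  have h1 : s' ≤ s + τ * ((N : ℝ) + 1) ^ (-(1 / 3 : ℝ)) := hs'.2
  have h2 : τ * ((N : ℝ) + 1) ^ (-(1 / 3 : ℝ)) ≤ τ * 1 :=
    mul_le_mul_of_nonneg_left hpow hτ.le
  linarith [hs.2]

/-- **S2a″ passes rung 0** (certificate p102898 `stub_energyFluxCeilingRung0` restated in the S2a″
quantifier shape): at constant profiles `a, θ̄ > 0`, constant drift `u`, the all-windows energy-flux
ceiling holds for every horizon `T > 0` (indeed for all windows `s ≤ s′`). -/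
theorem energyFluxCeilingWindows_rung0 : ∀ (a θb : ℝ) (u : V3), 0 < a → 0 < θb →
    ∃ σ₀ : ℝ, 0 < σ₀ ∧ ∀ σ : ℝ, 0 < σ → σ < σ₀ → ∀ T : ℝ, 0 < T →
      ∀ Φ : ((N : ℕ) → HardSphereFlow (Torus.geometry (Fin 3)) (hsDiameter σ N) (N + 1)),
        ∃ C : ℝ, 0 ≤ C ∧ ∃ N₀ : ℕ, ∀ N : ℕ, N₀ ≤ N → ∀ s s' : ℝ, 0 ≤ s → s ≤ s' → s' ≤ T →
          (∫⁻ z, ENNReal.ofReal (((N : ℝ) + 1)⁻¹ *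
              (Φ N).collisionSum (Set.Ioc s s')
                (fun col => ‖col.preVel.1‖ ^ 2 * ‖col.preVel.2‖ ^ 2) z)
            ∂(localGibbsLaw σ (fun _ => a) (fun _ => u) (fun _ => θb) N (Φ N)))
          ≤ ENNReal.ofReal (C * (σ ^ 2 * ((N : ℝ) + 1) ^ (1 / 3 : ℝ) * (s' - s))) *
              (⨆ r ∈ Set.Icc s s',
                (∫⁻ z, ENNReal.ofReal (((N : ℝ) + 1)⁻¹ *
                    ∑ i : Fin (N + 1), ‖((Φ N).flow r z i).2‖ ^ 2)
                  ∂(localGibbsLaw σ (fun _ => a) (fun _ => u) (fun _ => θb) N (Φ N)))) *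
              (⨆ r ∈ Set.Icc s s',
                (∫⁻ z, ENNReal.ofReal (((N : ℝ) + 1)⁻¹ *
                    ∑ i : Fin (N + 1), ‖((Φ N).flow r z i).2‖ ^ 3)
                  ∂(localGibbsLaw σ (fun _ => a) (fun _ => u) (fun _ => θb) N (Φ N)))) := by
  intro a θb u ha hθ
  obtain ⟨σ₀, hσ₀, H⟩ := stub_energyFluxCeilingRung0 a θb u ha hθ
  refine ⟨σ₀, hσ₀, fun σ hσ hσlt T _hT Φ => ?_⟩
  obtain ⟨K, hK, N₀, HN⟩ := H σ hσ hσlt Φ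
  exact ⟨K, hK, N₀, fun N hN s s' _hs hss' _hs'T => HN N hN s s' hss'⟩

end Summit.AtomisticToContinuum.HydrodynamicLimit.Theorems.QuarticSchurLedger
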